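import Summits.Parity.GeneralizedHardyLittlewood.Theorems.LiouvilleShiftedTablesElliottHalberstamLiftingLever

/-!
# `ElliottHalberstam` (stmt-Parity-14092): level lifting, II — the W-trick / multiples normal form

Support lemmas for the crux `LiouvilleShiftedTables.ElliottHalberstam` (= `LiouvilleMAD.ElliottHalberstam` =
`Literature.NumberTheory.Sieve.LevelOfDistribution.ElliottHalberstam`, by `rfl`), line `LiftProof`
(card `smooth-cofactor-lifting`, ideator 2; from the kernel-checked work file `Cruxes/ElliottHalberstam/LiftingProved.lean`).

* `PrimesHaveLevelMultiples θ k₀` — the Bombieri–Vinogradov/EH shape at level `x^{θ−ε}` restricted to the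
  MULTIPLES of a prescribed `k₀ = k₀(x)`, normalised by the factor `k₀`.
* `primesHaveLevel_of_multiples` — LEVEL LIFTING, multiples form: if `1 ≤ k₀(x) ≤ x^κ` eventually and the
  multiples of `k₀(x)` satisfy the bound at level `θ + κ ≤ 1`, then ALL moduli satisfy it at level `θ`
  (pointwise lever `primeAPError_le_lift` with `k = k₀(x)`, `φ(qk₀)/φ(q) ≤ k₀`, `ω(k₀) log x ≤ k₀ log x`, and
  `x^{θ−ε} · x^κ · log x = o(x/(log x)^A)`).
* `elliottHalberstam_iff_multiples_const` — THE W-TRICK EQUIVALENCE: for every fixed `k₀ ≥ 1`, EH is equivalent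
  to its restriction to the multiples of `k₀` ("WLOG every modulus is divisible by `k₀`").

Nothing here asserts the crux (the Elliott–Halberstam conjecture, open); the equivalence is a NORMAL FORM.
-/

namespace Summit.Parity.GeneralizedHardyLittlewood.Theorems.ElliottHalberstam.Lifting

open scoped BigOperators Classical ArithmeticFunction.vonMangoldt
open Filter Finset Real
open Literature.NumberTheory.Sieve (primeAPError primeAPError_nonneg abs_sub_le_primeAPError)
open Literature.NumberTheory.Sieve.LevelOfDistribution (chebyshevPsiMod)

/-! ### The W-trick / multiples normal form, PROVED: EH on multiples of `k₀(x) ≤ x^κ` at level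
`θ + κ` gives EH for all moduli at level `θ`. -/

open Literature.NumberTheory.Sieve (PrimesHaveLevel rpow_mul_log_le_div_eventually)

/-- EH-shape at level `x^{θ−ε}` restricted to the MULTIPLES of a prescribed `k₀ = k₀(x)`, with the
natural normalisation factor `k₀` in front. -/
def PrimesHaveLevelMultiples (θ : ℝ) (k₀ : ℝ → ℕ) : Prop :=
  ∀ A : ℝ, 0 < A → ∀ ε : ℝ, 0 < ε →
    (fun x : ℝ => (k₀ x : ℝ) *
        ∑ q ∈ (Icc 1 ⌊x ^ (θ - ε)⌋₊).filter (fun q => k₀ x ∣ q), primeAPError x q)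
      =O[atTop] fun x : ℝ => x / Real.log x ^ A

/-- LEVEL LIFTING, multiples form (PROVED): if `1 ≤ k₀(x) ≤ x^κ` eventually and the multiples of
`k₀(x)` satisfy the EH-bound at level `θ + κ ≤ 1`, then ALL moduli satisfy it at level `θ`. -/
theorem primesHaveLevel_of_multiples {θ κ : ℝ} (hθκ : θ + κ ≤ 1) (k₀ : ℝ → ℕ)
    (hk₁ : ∀ᶠ x in atTop, 1 ≤ k₀ x) (hk₂ : ∀ᶠ x in atTop, (k₀ x : ℝ) ≤ x ^ κ)
    (h : PrimesHaveLevelMultiples (θ + κ) k₀) : PrimesHaveLevel θ := by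
  intro A hA ε hε
  set g : ℝ → ℝ := fun x => (k₀ x : ℝ) *
      ∑ r ∈ (Icc 1 ⌊x ^ (θ + κ - ε)⌋₊).filter (fun r => k₀ x ∣ r), primeAPError x r with hg
  have hgO : g =O[atTop] fun x : ℝ => x / Real.log x ^ A := by
    rw [hg]; exact h A hA ε hε
  have herr := rpow_mul_log_le_div_eventually hε A
  -- pointwise bound, eventually
  have hpt : ∀ᶠ x : ℝ in atTop,
      ∑ q ∈ Icc 1 ⌊x ^ (θ - ε)⌋₊, primeAPError x q ≤ g x + x / Real.log x ^ A := by
    filter_upwards [hk₁, hk₂, herr, eventually_ge_atTop (1 : ℝ)] with x hx1 hx2 hxerr hx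
    have hk0 : k₀ x ≠ 0 := by omega
    have hx0 : 0 < x := by linarith
    have hlog0 : 0 ≤ Real.log x := Real.log_nonneg hx
    -- `ω(k₀) ≤ k₀` (prime factors are among `1, …, k₀`)
    have hω : ((k₀ x).primeFactors.card : ℝ) ≤ (k₀ x : ℝ) := by
      have : (k₀ x).primeFactors.card ≤ (Icc 1 (k₀ x)).card :=
        Finset.card_le_card fun p hp =>
          Finset.mem_Icc.mpr ⟨(Nat.prime_of_mem_primeFactors hp).one_lt.le,
            Nat.le_of_mem_primeFactors hp⟩
      rw [Nat.card_Icc, Nat.add_sub_cancel] at this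
      exact_mod_cast this
    -- step 1: pointwise lifting, summed over q
    have step1 : ∑ q ∈ Icc 1 ⌊x ^ (θ - ε)⌋₊, primeAPError x q ≤
        ∑ q ∈ Icc 1 ⌊x ^ (θ - ε)⌋₊,
          ((k₀ x : ℝ) * primeAPError x (q * k₀ x) + (k₀ x : ℝ) * Real.log x) := by
      refine Finset.sum_le_sum fun q hq => ?_
      rw [Finset.mem_Icc] at hq
      have hq0 : q ≠ 0 := by omega
      haveI : NeZero q := ⟨hq0⟩
      haveI : NeZero (q * k₀ x) := ⟨mul_ne_zero hq0 hk0⟩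
      refine (primeAPError_le_lift hq0 hk0 hx).trans ?_
      exact add_le_add
        (mul_le_mul_of_nonneg_right totient_ratio_le (primeAPError_nonneg _ _))
        (mul_le_mul_of_nonneg_right hω hlog0)
    rw [Finset.sum_add_distrib, ← Finset.mul_sum, Finset.sum_const, Nat.card_Icc,
      Nat.add_sub_cancel, nsmul_eq_mul] at step1
    -- step 2: reindex the lifted moduli as multiples of k₀ up to x^{θ+κ-ε}
    have hQK : ⌊x ^ (θ - ε)⌋₊ * k₀ x ≤ ⌊x ^ (θ + κ - ε)⌋₊ := by
      refine Nat.le_floor ?_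
      push_cast
      calc (⌊x ^ (θ - ε)⌋₊ : ℝ) * (k₀ x : ℝ) ≤ x ^ (θ - ε) * x ^ κ :=
            mul_le_mul (Nat.floor_le (Real.rpow_nonneg hx0.le _)) hx2 (Nat.cast_nonneg _)
              (Real.rpow_nonneg hx0.le _)
        _ = x ^ (θ + κ - ε) := by
            rw [← Real.rpow_add hx0, show θ - ε + κ = θ + κ - ε by ring]
    have hinj : ∀ q₁ ∈ Icc 1 ⌊x ^ (θ - ε)⌋₊, ∀ q₂ ∈ Icc 1 ⌊x ^ (θ - ε)⌋₊,
        q₁ * k₀ x = q₂ * k₀ x → q₁ = q₂ :=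
      fun q₁ _ q₂ _ h' => Nat.eq_of_mul_eq_mul_right (Nat.pos_of_ne_zero hk0) h'
    have step2 : ∑ q ∈ Icc 1 ⌊x ^ (θ - ε)⌋₊, primeAPError x (q * k₀ x) ≤
        ∑ r ∈ (Icc 1 ⌊x ^ (θ + κ - ε)⌋₊).filter (fun r => k₀ x ∣ r), primeAPError x r := by
      calc ∑ q ∈ Icc 1 ⌊x ^ (θ - ε)⌋₊, primeAPError x (q * k₀ x)
          = ∑ r ∈ (Icc 1 ⌊x ^ (θ - ε)⌋₊).image (fun q => q * k₀ x), primeAPError x r :=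
            (Finset.sum_image hinj).symm
        _ ≤ _ := by
            refine Finset.sum_le_sum_of_subset_of_nonneg ?_ fun r _ _ => primeAPError_nonneg x r
            intro r hr
            rw [Finset.mem_image] at hr
            obtain ⟨q, hq, rfl⟩ := hr
            rw [Finset.mem_Icc] at hq
            rw [Finset.mem_filter, Finset.mem_Icc]
            refine ⟨⟨Nat.one_le_iff_ne_zero.mpr (mul_ne_zero (by omega) hk0), ?_⟩, dvd_mul_left _ _⟩
            exact (Nat.mul_le_mul_right _ hq.2).trans hQK
    -- step 3: the error term
    have step3 : (⌊x ^ (θ - ε)⌋₊ : ℝ) * ((k₀ x : ℝ) * Real.log x) ≤ x / Real.log x ^ A := by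
      calc (⌊x ^ (θ - ε)⌋₊ : ℝ) * ((k₀ x : ℝ) * Real.log x)
          ≤ x ^ (θ - ε) * (x ^ κ * Real.log x) :=
            mul_le_mul (Nat.floor_le (Real.rpow_nonneg hx0.le _))
              (mul_le_mul_of_nonneg_right hx2 hlog0) (by positivity) (Real.rpow_nonneg hx0.le _)
        _ = x ^ (θ + κ - ε) * Real.log x := by
            rw [← mul_assoc, ← Real.rpow_add hx0, show θ - ε + κ = θ + κ - ε by ring]
        _ ≤ x ^ (1 - ε) * Real.log x :=
            mul_le_mul_of_nonneg_right (Real.rpow_le_rpow_of_exponent_le hx (by linarith)) hlog0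
        _ ≤ x / Real.log x ^ A := hxerr
    calc ∑ q ∈ Icc 1 ⌊x ^ (θ - ε)⌋₊, primeAPError x q
        ≤ (k₀ x : ℝ) * ∑ q ∈ Icc 1 ⌊x ^ (θ - ε)⌋₊, primeAPError x (q * k₀ x)
            + (⌊x ^ (θ - ε)⌋₊ : ℝ) * ((k₀ x : ℝ) * Real.log x) := step1
      _ ≤ g x + x / Real.log x ^ A := by
          simp only [hg]
          exact add_le_add (mul_le_mul_of_nonneg_left step2 (Nat.cast_nonneg _)) step3
  -- conclude
  have hsumO : (fun x : ℝ => g x + x / Real.log x ^ A) =O[atTop] fun x : ℝ => x / Real.log x ^ A :=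
    hgO.add (Asymptotics.isBigO_refl _ _)
  refine Asymptotics.IsBigO.trans (Asymptotics.IsBigO.of_bound 1 ?_) hsumO
  filter_upwards [hpt, eventually_gt_atTop (1 : ℝ)] with x hx hx1
  have h0 : 0 ≤ ∑ q ∈ Icc 1 ⌊x ^ (θ - ε)⌋₊, primeAPError x q :=
    Finset.sum_nonneg fun q _ => primeAPError_nonneg x q
  have hg0 : 0 ≤ g x := by
    simp only [hg]
    exact mul_nonneg (Nat.cast_nonneg _) (Finset.sum_nonneg fun r _ => primeAPError_nonneg x r)
  have hd0 : 0 ≤ x / Real.log x ^ A :=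
    div_nonneg (by linarith) (Real.rpow_nonneg (Real.log_nonneg hx1.le) _)
  rw [one_mul, Real.norm_eq_abs, Real.norm_eq_abs, abs_of_nonneg h0,
    abs_of_nonneg (add_nonneg hg0 hd0)]
  exact hx

/-- Conversely (trivially), a level of distribution gives the multiples form for any CONSTANT `k₀`
(sub-sum of nonnegative terms, constant factor). -/
theorem primesHaveLevelMultiples_const_of_primesHaveLevel {θ : ℝ} (k₀ : ℕ)
    (h : PrimesHaveLevel θ) : PrimesHaveLevelMultiples θ (fun _ => k₀) := by
  intro A hA ε hε
  refine Asymptotics.IsBigO.trans (Asymptotics.IsBigO.of_bound (k₀ : ℝ) ?_) (h A hA ε hε)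
  filter_upwards with x
  have h0 : ∀ q, 0 ≤ primeAPError x q := fun q => primeAPError_nonneg x q
  rw [Real.norm_eq_abs, Real.norm_eq_abs,
    abs_of_nonneg (mul_nonneg (Nat.cast_nonneg _) (Finset.sum_nonneg fun q _ => h0 q)),
    abs_of_nonneg (Finset.sum_nonneg fun q _ => h0 q)]
  exact mul_le_mul_of_nonneg_left
    (Finset.sum_le_sum_of_subset_of_nonneg (Finset.filter_subset _ _) fun q _ _ => h0 q)
    (Nat.cast_nonneg _)

/-- Multiples form with a CONSTANT auxiliary factor `k₀ ≥ 1`: level `θ + κ` on the multiples of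
`k₀` gives level `θ` for all moduli (`0 < κ`, `θ + κ ≤ 1`). -/
theorem primesHaveLevel_of_multiples_const {θ κ : ℝ} (hκ : 0 < κ) (hθκ : θ + κ ≤ 1) {k₀ : ℕ}
    (hk : 1 ≤ k₀) (h : PrimesHaveLevelMultiples (θ + κ) (fun _ => k₀)) : PrimesHaveLevel θ :=
  primesHaveLevel_of_multiples hθκ (fun _ => k₀) (Eventually.of_forall fun _ => hk)
    ((tendsto_rpow_atTop hκ).eventually_ge_atTop (k₀ : ℝ)) h

/-- THE W-TRICK EQUIVALENCE (PROVED): for every fixed `k₀ ≥ 1`, the Elliott–Halberstam conjecture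
is equivalent to its restriction to the multiples of `k₀` (with the factor `k₀` normalisation):
"WLOG every modulus is divisible by `k₀`". -/
theorem elliottHalberstam_iff_multiples_const {k₀ : ℕ} (hk : 1 ≤ k₀) :
    Literature.NumberTheory.Sieve.LevelOfDistribution.ElliottHalberstam ↔
      ∀ θ : ℝ, θ < 1 → PrimesHaveLevelMultiples θ (fun _ => k₀) := by
  constructor
  · intro h θ hθ
    exact primesHaveLevelMultiples_const_of_primesHaveLevel k₀ (h θ hθ)
  · intro h θ hθ
    set θ' : ℝ := max θ 0 with hθ'
    have hθ'1 : θ' < 1 := max_lt hθ one_pos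
    have hκ : 0 < (1 - θ') / 2 := by linarith
    have h1 : PrimesHaveLevelMultiples (θ' + (1 - θ') / 2) (fun _ => k₀) :=
      h (θ' + (1 - θ') / 2) (by linarith)
    exact (primesHaveLevel_of_multiples_const hκ (by linarith) hk h1).mono (le_max_left _ _)

end Summit.Parity.GeneralizedHardyLittlewood.Theorems.ElliottHalberstam.Lifting
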